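import Summits.ResolutionOfSingularities.ResolutionOfSingularities.Theorems.EquisingularLiftEquisingularLiftNatResidueHypDefsE9Prime
import Literature.AlgebraicGeometry.Resolution.BlowupSequencesBaseChange
import HarnessLib

/-!
# [OURS · L1 W4.5(b) · EL♮ / EL♮(3)] RESIDUE HYPOTHESIS DEFS E10 — D18 «DESCENT-CERTIFICATE DOOR»: `DescCentresSmoothOver`, `DescTransformOK`,
# `DescDoor` and the top-level disjunction blob E10 `NoseHypHostedNestEquinodalDirectCILiftTowerZeroPrimeSigmaPGBTriplePrimeDesc₂ := E9′ ∨ DescDoor`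

Typed by res-type-027 g24 on the desk's RULING R88 (2026-08-29T14:09:39Z, «D18 DEALT AS THE 53rd»; pre-draft invited by R88-PRE 13:59Z on idea-2
g32's `D18-LETTERS-idea2.md` v1.2 7a3aaa2cf04a3a2a / v1.3 70e65a9db43b7957 (A1) 4-ary `TransformOK`; pre-clears idea-2 g32 PASS ×2, gate (c) crit-3 g13
`GATE-C-D18-by-letters.md` edf321070a71e8c9 PASS (F1 moot against these bytes: θ is a bound ring map, ∀θ idiom; F2–F4 engine-side) + crit-2 g14 token
twin; kernel replays stub-2 g21 #1/#2).  Customer of record: #4 = H₁₀ ⊃ Z₁₅, the first RIGID SPECIMEN (R85 (2)).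

THE IDEA (idea-2 (L0)–(L3); idea-3 (12.7)).  The tree's spreading-out library `Literature/AlgebraicGeometry/Resolution/BlowupSequences*`
already proves: a multiple blow-up `s : CentreSeq X` of a `D`-scheme `q : X ⟶ Spec D` whose exceptional divisors are `D`-flat
(✓ `CentreSeq.ExceptionalFlatOver s q`) base-changes, stage by stage, to the induced multiple blow-up `s.comap ι` over ANY `Spec E → Spec D`
(✓ `CentreSeq.isPullback_comap_specMap_of_exceptionalFlatOver`).  So an H whose embedded resolution word is given by ARITHMETIC centres —
a `CentreSeq` of `ℙⁿ_B`, `B := ℤ[1/N]` with `N ∈ kˣ`, all centres SMOOTH over `B` — gets its EL♮ word over EVERY `O` (and its k-side word) by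
base change `B → O` / `B → k`: no lifting Fact, no `O` in the letters (ARCHITECTURE NOTE A-1 clean), stronger than the crux's `∃ O` by
uniformity.  WHAT.  (1) `DescCentresSmoothOver s q` — every centre of `s` is SMOOTH over `Spec D` (recursive, the shape of ✓ `ExceptionalFlatOver`).
(2) `DescTransformOK s σ Y₀ Y` (4-ary, idea-2 v1.3 (A1)) — the k-side E1/END tokens of ✓ `ELNatConclusionO` read on a GIVEN tower over the stage map
`σ : X ⟶ P`: at each stage the centre's support lies in the running transform `Y` and its `σ`-image avoids the generic point of the ORIGINAL `Y₀` (the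
Fact's position token verbatim), the transform becomes `closure (π⁻¹(Y ∖ supp C))` (= ✓ `CentreSeq.strictTransform`'s step); at the end the reduced
structure on `closure Y` is regular.  (3) `DescDoorOver B k n H ι` (typing helper, any base ring `B`) / `DescDoor k n H ι` — `∃ N, (N : k) ≠ 0 ∧` over `B := ℤ[1/N]`: `∃ s : CentreSeq ℙⁿ_B`,
`ExceptionalFlatOver` ∧ `DescCentresSmoothOver` over `Spec ℤ[1/N]`, and for every ring map `θ : ℤ[1/N] → k` with its graded lift `φ`
(the φ-idiom of ✓ `ELNatConclusionO` / ✓ `NoseLift₀`) such that `Proj.map φ` sits in the standard fibre square, `DescTransformOK (s.comap (Proj.map φ))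
(Set.range ι)`.  (4) blob E10 := blob E9′ (✓ …DefsE9Prime) `∨ DescDoor k n H ι` — a TOP-LEVEL disjunction (idea-2 (L3): no interaction with
τ0′ letters, hosts, `InvB₄`).  (5) pure logic: E9′ ⇒ E10 (`Or.inl`), `DescDoor` ⇒ E10 (`Or.inr`), the REPLACE lemma
`not_…LiftTowerZeroPrimeSigmaPGBTriplePrime₂_of_not_…Desc₂` (¬E10 → ¬E9′) and the chain down to `NoseHypPointsFirstBTriplePrime`.
Engine (not here; nose-w1 / stub-4 per R88-PRE): `descDoor_elnat : DescDoor k n H ι → ELNatConclusionO k n H ι` by (E0) O := 𝕎(k) (✓ `stub_wittRing`),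
(E1) ✓ `ProjBaseChangeRing.isPullback_projMap'`, (E2) ✓ `isPullback_comap_specMap_of_exceptionalFlatOver` ×2, (E3) ✓ `smooth_subschemeι_comap_comp` +
✓ `isRegularLocalRing_stalk_of_smooth_dvr`, (E4) set bookkeeping through the squares; rung `nose_desc_rung_three`.
OURS; NAMED HYPOTHESES, not statements of any manuscript ([Hironaka2017] is a candidate, nothing of it is asserted); AI-written, weaker than
expert review; definitions + pure logic only, no instance, no notation, standard axioms; EL♮(3) NOT proved; resolution in positive
characteristic NOT proved.  `--kind definition --supports stmt-ResolutionOfSingularities-20148 --as helper`.  Names on the desk's / lead-2's word.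
-/

set_option linter.dupNamespace false
noncomputable section
open CategoryTheory CategoryTheory.Limits AlgebraicGeometry TopologicalSpace Topology IsLocalRing
open Literature.AlgebraicGeometry.Resolution
open AlgebraicGeometry.Scheme.IdealSheafData
namespace Summit.ResolutionOfSingularities.ResolutionOfSingularities.Cruxes.EquisingularLiftNat.Sections

/-- **`DescCentresSmoothOver s q`** — every centre of the multiple blow-up `s : CentreSeq X` of the `D`-scheme `q : X ⟶ Spec D` is SMOOTH over
`Spec D` (recursively: `Smooth (C₀.subschemeι ≫ q)` and the same for the rest over `blowup.π C₀ ≫ q`); the shape of ✓ `CentreSeq.ExceptionalFlatOver`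
with `Flat (exceptional …)` ↦ `Smooth (centre …)` (idea-2 D18-LETTERS §1 `CentresSmoothOver`).  Smooth over a DVR ⇒ flat and regular
(✓ `isRegularLocalRing_stalk_of_smooth_dvr`) — the engine's (E3). [OURS · named hypothesis fragment, no mathematical content of its own] -/
def DescCentresSmoothOver {D : Type} [CommRing D] : {X : Scheme.{0}} → CentreSeq X → (X ⟶ Spec (.of D)) → Prop
  | _, .nil _, _ => True
  | _, .cons C rest, q => AlgebraicGeometry.Smooth (C.subschemeι ≫ q) ∧ DescCentresSmoothOver rest (blowup.π C ≫ q)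

/-- **`DescTransformOK s σ Y₀ Y`** — the k-side E1/END tokens of ✓ `ELNatConclusionO` read on a GIVEN multiple blow-up `s : CentreSeq X` of a
stage `σ : X ⟶ P` over the initial ambient `P` (`Y₀ ⊆ P` the ORIGINAL image of `H`, `Y ⊆ X` the RUNNING transform): for `s = (C, rest)` the
centre's support lies INSIDE `Y` (E1), its image under `σ` avoids the generic point of `Y₀` (the Fact's position token VERBATIM — idea-2 v1.3 (A1):
no birationality lemma is owed by the engine), and the rest is OK for `(blowup.π C ≫ σ, Y₀, closure ((blowup.π C)⁻¹' (Y ∖ supp C)))`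
(✓ `CentreSeq.strictTransform`'s step); for `s = nil` the reduced induced structure on `closure Y` is REGULAR (END).  No regularity-of-centre
token: it follows from `DescCentresSmoothOver` over `k` (✓ `isRegular_subscheme_comap_of_smooth`).  Called by the door with `σ := 𝟙 ℙⁿ_k`,
`Y₀ = Y := Set.range ι`. (idea-2 D18-LETTERS v1.3 §1 `TransformOK`, 4-ary form) [OURS · named hypothesis fragment, no mathematical content of its own] -/
def DescTransformOK {P : Scheme.{0}} : {X : Scheme.{0}} → CentreSeq X → (X ⟶ P) → Set P → Set X → Prop
  | X, .nil _, _, _, Y => Literature.AlgebraicGeometry.Resolution.Scheme.IsRegular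
      (AlgebraicGeometry.Scheme.IdealSheafData.vanishingIdeal (⟨closure Y, isClosed_closure⟩ : TopologicalSpace.Closeds X)).subscheme
  | X, .cons C rest, σ, Y₀, Y => (C.support : Set X) ⊆ Y ∧ σ '' (C.support : Set X) ⊆ {x | ¬ IsGenericPoint x Y₀} ∧
      DescTransformOK rest (blowup.π C ≫ σ) Y₀ (closure ((blowup.π C) ⁻¹' (Y \ (C.support : Set X))))

/-- **`DescDoorOver B k n H ι`** — the DESCENT CERTIFICATE over a given base ring `B` (typing helper for `DescDoor`, which takes
`B := ℤ[1/N]`): a multiple blow-up `s : CentreSeq ℙⁿ_B` of `ℙⁿ_B → Spec B` whose EXCEPTIONAL DIVISORS ARE `B`-FLAT (✓ `CentreSeq.ExceptionalFlatOver`)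
and whose CENTRES ARE `B`-SMOOTH (`DescCentresSmoothOver`), such that for every ring map `θ : B →+* k` and every graded lift `φ` of it
(`∀ t, φ t = MvPolynomial.map θ t`; the φ-idiom of ✓ `NoseLift₀`) for which `Proj.map φ : ℙⁿ_k ⟶ ℙⁿ_B` sits in the standard fibre square over
`Spec θ`, the induced k-tower `s.comap (Proj.map φ)` is an embedded resolution word for `range ι` (`DescTransformOK … (𝟙 _) (range ι) (range ι)`).
[OURS · L1 W4.5b · named hypothesis fragment, no mathematical content of its own] -/
def DescDoorOver (B : Type) [CommRing B] (k : Type) [Field k] (n : ℕ) (H : AlgebraicGeometry.Scheme.{0})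
    (ι : H ⟶ (Literature.AlgebraicGeometry.Motives.projectiveSpace n k).left) : Prop :=
  letI := MvPolynomial.gradedAlgebra (σ := Fin (n + 1)) (R := B)
  letI := MvPolynomial.gradedAlgebra (σ := Fin (n + 1)) (R := k)
  ∃ s : CentreSeq (AlgebraicGeometry.Proj (MvPolynomial.homogeneousSubmodule (Fin (n + 1)) B)),
    s.ExceptionalFlatOver
        (AlgebraicGeometry.Proj.toSpecZero (MvPolynomial.homogeneousSubmodule (Fin (n + 1)) B) ≫
          AlgebraicGeometry.Spec.map (CommRingCat.ofHom (algebraMap B (MvPolynomial.homogeneousSubmodule (Fin (n + 1)) B 0)))) ∧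
    DescCentresSmoothOver s
        (AlgebraicGeometry.Proj.toSpecZero (MvPolynomial.homogeneousSubmodule (Fin (n + 1)) B) ≫
          AlgebraicGeometry.Spec.map (CommRingCat.ofHom (algebraMap B (MvPolynomial.homogeneousSubmodule (Fin (n + 1)) B 0)))) ∧
    ∀ (θ : B →+* k)
      (φ : MvPolynomial.homogeneousSubmodule (Fin (n + 1)) B →+*ᵍ MvPolynomial.homogeneousSubmodule (Fin (n + 1)) k)
      (hφ' : HomogeneousIdeal.irrelevant (MvPolynomial.homogeneousSubmodule (Fin (n + 1)) k) ≤
        (HomogeneousIdeal.irrelevant (MvPolynomial.homogeneousSubmodule (Fin (n + 1)) B)).map φ),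
      (∀ t, φ t = MvPolynomial.map θ t) →
      -- the standard fibre square over `Spec θ` (the engine has it by ✓ `ProjBaseChangeRing.isPullback_projMap'`; customers may use it freely)
      IsPullback (AlgebraicGeometry.Proj.map φ hφ' :
            (Literature.AlgebraicGeometry.Motives.projectiveSpace n k).left ⟶ AlgebraicGeometry.Proj (MvPolynomial.homogeneousSubmodule (Fin (n + 1)) B))
          (AlgebraicGeometry.Proj.toSpecZero (MvPolynomial.homogeneousSubmodule (Fin (n + 1)) k) ≫
            AlgebraicGeometry.Spec.map (CommRingCat.ofHom (algebraMap k (MvPolynomial.homogeneousSubmodule (Fin (n + 1)) k 0))))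
          (AlgebraicGeometry.Proj.toSpecZero (MvPolynomial.homogeneousSubmodule (Fin (n + 1)) B) ≫
            AlgebraicGeometry.Spec.map (CommRingCat.ofHom (algebraMap B (MvPolynomial.homogeneousSubmodule (Fin (n + 1)) B 0))))
          (AlgebraicGeometry.Spec.map (CommRingCat.ofHom θ)) →
      DescTransformOK (s.comap (AlgebraicGeometry.Proj.map φ hφ' :
            (Literature.AlgebraicGeometry.Motives.projectiveSpace n k).left ⟶ AlgebraicGeometry.Proj (MvPolynomial.homogeneousSubmodule (Fin (n + 1)) B)))
        (𝟙 (Literature.AlgebraicGeometry.Motives.projectiveSpace n k).left) (Set.range ι) (Set.range ι)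

/-- **`DescDoor k n H ι`** — door D18 «DESCENT CERTIFICATE» (idea-2 D18-LETTERS v1.2 §1; idea-3 DEEPPT (12.7); desk R85 (3) / R88-PRE): there is
`N : ℕ` INVERTIBLE IN `k` (`(N : k) ≠ 0`, so that `B := ℤ[1/N] = Localization.Away (N : ℤ)` maps to `k` and to `𝕎(k)`) with `DescDoorOver ℤ[1/N] k n H ι`.
No `O`, no lifting slot, no Fact (ARCHITECTURE NOTE A-1 clean); the engine base-changes the certificate along `B → 𝕎(k)` and `B → k`
(✓ `CentreSeq.isPullback_comap_specMap_of_exceptionalFlatOver` ×2).  Customers: H-INDEPENDENT words only (frame strata, orbit closures, fixed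
`B`-curves — the rigid specimens' class, #4 = H₁₀ ⊃ Z₁₅). [OURS · L1 W4.5b · named hypothesis fragment, no mathematical content of its own] -/
def DescDoor (k : Type) [Field k] (n : ℕ) (H : AlgebraicGeometry.Scheme.{0})
    (ι : H ⟶ (Literature.AlgebraicGeometry.Motives.projectiveSpace n k).left) : Prop :=
  ∃ (N : ℕ), (N : k) ≠ 0 ∧ DescDoorOver (Localization.Away (N : ℤ)) k n H ι

/-- **`NoseHypHostedNestEquinodalDirectCILiftTowerZeroPrimeSigmaPGBTriplePrimeDesc₂ k n H ι`** (blob E10) — the TOP-LEVEL disjunction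
«blob E9′ ∨ D18»: ✓ `NoseHypHostedNestEquinodalDirectCILiftTowerZeroPrimeSigmaPGBTriplePrime₂ k n H ι` (…DefsE9Prime, the 52nd's residue blob)
`∨ DescDoor k n H ι` (idea-2 (L3): no interaction with the τ0′ letters, hosts, `InvB₄`).  REPLACE shape «¬(E9′ blob) ↦ ¬(this blob)» (53rd-or-later,
desk R88).  [OURS · L1 W4.5b · named hypothesis, no mathematical content of its own] -/
def NoseHypHostedNestEquinodalDirectCILiftTowerZeroPrimeSigmaPGBTriplePrimeDesc₂ (k : Type) [Field k] [IsAlgClosed k] (n : ℕ)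
    (H : AlgebraicGeometry.Scheme.{0}) (ι : H ⟶ (Literature.AlgebraicGeometry.Motives.projectiveSpace n k).left) : Prop :=
  NoseHypHostedNestEquinodalDirectCILiftTowerZeroPrimeSigmaPGBTriplePrime₂ k n H ι ∨ DescDoor k n H ι

/-- blob E9′ ⇒ blob E10 (`Or.inl`). [OURS · pure logic] -/
theorem noseHypHostedNestEquinodalDirectCILiftTowerZeroPrimeSigmaPGBTriplePrimeDesc₂_of_liftTowerZeroPrimeSigmaPG₂ (k : Type) [Field k]
    [IsAlgClosed k] (n : ℕ) (H : AlgebraicGeometry.Scheme.{0}) (ι : H ⟶ (Literature.AlgebraicGeometry.Motives.projectiveSpace n k).left)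
    (h : NoseHypHostedNestEquinodalDirectCILiftTowerZeroPrimeSigmaPGBTriplePrime₂ k n H ι) :
    NoseHypHostedNestEquinodalDirectCILiftTowerZeroPrimeSigmaPGBTriplePrimeDesc₂ k n H ι :=
  Or.inl h

/-- `DescDoor` ⇒ blob E10 (`Or.inr`). [OURS · pure logic] -/
theorem noseHypHostedNestEquinodalDirectCILiftTowerZeroPrimeSigmaPGBTriplePrimeDesc₂_of_descDoor (k : Type) [Field k]
    [IsAlgClosed k] (n : ℕ) (H : AlgebraicGeometry.Scheme.{0}) (ι : H ⟶ (Literature.AlgebraicGeometry.Motives.projectiveSpace n k).left)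
    (h : DescDoor k n H ι) :
    NoseHypHostedNestEquinodalDirectCILiftTowerZeroPrimeSigmaPGBTriplePrimeDesc₂ k n H ι :=
  Or.inr h

/-- the ΣPG blob / E8 / E9′ chain ⇒ blob E10. [OURS · pure logic] -/
theorem noseHypHostedNestEquinodalDirectCILiftTowerZeroPrimeSigmaPGBTriplePrimeDesc₂_of_liftSigmaPG₂ (k : Type) [Field k]
    [IsAlgClosed k] (n : ℕ) (H : AlgebraicGeometry.Scheme.{0}) (ι : H ⟶ (Literature.AlgebraicGeometry.Motives.projectiveSpace n k).left)
    (h : NoseHypHostedNestEquinodalDirectCILiftSigmaPGBTriplePrime₂ k n H ι) :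
    NoseHypHostedNestEquinodalDirectCILiftTowerZeroPrimeSigmaPGBTriplePrimeDesc₂ k n H ι :=
  Or.inl (noseHypHostedNestEquinodalDirectCILiftTowerZeroPrimeSigmaPGBTriplePrime₂_of_liftSigmaPG₂ k n H ι h)

/-- Contrapositive, as a D18 REPLACE cut «¬(E9′ blob) ↦ ¬(E10 blob)» consumes it: the new residue hypothesis implies the old one. [OURS · pure logic] -/
theorem not_noseHypHostedNestEquinodalDirectCILiftTowerZeroPrimeSigmaPGBTriplePrime₂_of_not_liftTowerZeroPrimeSigmaPGDesc₂ (k : Type)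
    [Field k] [IsAlgClosed k] (n : ℕ) (H : AlgebraicGeometry.Scheme.{0})
    (ι : H ⟶ (Literature.AlgebraicGeometry.Motives.projectiveSpace n k).left)
    (h : ¬ NoseHypHostedNestEquinodalDirectCILiftTowerZeroPrimeSigmaPGBTriplePrimeDesc₂ k n H ι) :
    ¬ NoseHypHostedNestEquinodalDirectCILiftTowerZeroPrimeSigmaPGBTriplePrime₂ k n H ι :=
  fun h' => h (Or.inl h')

/-- … `¬ (E10 blob) → ¬ DescDoor`. [OURS · pure logic] -/
theorem not_descDoor_of_not_liftTowerZeroPrimeSigmaPGDesc₂ (k : Type) [Field k] [IsAlgClosed k] (n : ℕ)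
    (H : AlgebraicGeometry.Scheme.{0}) (ι : H ⟶ (Literature.AlgebraicGeometry.Motives.projectiveSpace n k).left)
    (h : ¬ NoseHypHostedNestEquinodalDirectCILiftTowerZeroPrimeSigmaPGBTriplePrimeDesc₂ k n H ι) : ¬ DescDoor k n H ι :=
  fun h' => h (Or.inr h')

/-- … `¬ (E10 blob) → ¬ (E8 blob)` (51st-level). [OURS · pure logic] -/
theorem not_noseHypHostedNestEquinodalDirectCILiftSigmaPGBTriplePrime₂_of_not_liftTowerZeroPrimeSigmaPGDesc₂ (k : Type) [Field k]
    [IsAlgClosed k] (n : ℕ) (H : AlgebraicGeometry.Scheme.{0}) (ι : H ⟶ (Literature.AlgebraicGeometry.Motives.projectiveSpace n k).left)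
    (h : ¬ NoseHypHostedNestEquinodalDirectCILiftTowerZeroPrimeSigmaPGBTriplePrimeDesc₂ k n H ι) :
    ¬ NoseHypHostedNestEquinodalDirectCILiftSigmaPGBTriplePrime₂ k n H ι :=
  not_noseHypHostedNestEquinodalDirectCILiftSigmaPGBTriplePrime₂_of_not_liftTowerZeroPrimeSigmaPG₂ k n H ι
    (not_noseHypHostedNestEquinodalDirectCILiftTowerZeroPrimeSigmaPGBTriplePrime₂_of_not_liftTowerZeroPrimeSigmaPGDesc₂ k n H ι h)

/-- … `¬ (E10 blob) → ¬ (ΣPG blob)` (50th-level). [OURS · pure logic] -/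
theorem not_noseHypHostedNestEquinodalDirectCISigmaPGBTriplePrime₂_of_not_liftTowerZeroPrimeSigmaPGDesc₂ (k : Type) [Field k]
    [IsAlgClosed k] (n : ℕ) (H : AlgebraicGeometry.Scheme.{0}) (ι : H ⟶ (Literature.AlgebraicGeometry.Motives.projectiveSpace n k).left)
    (h : ¬ NoseHypHostedNestEquinodalDirectCILiftTowerZeroPrimeSigmaPGBTriplePrimeDesc₂ k n H ι) :
    ¬ NoseHypHostedNestEquinodalDirectCISigmaPGBTriplePrime₂ k n H ι :=
  not_noseHypHostedNestEquinodalDirectCISigmaPGBTriplePrime₂_of_not_liftTowerZeroPrimeSigmaPG₂ k n H ι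
    (not_noseHypHostedNestEquinodalDirectCILiftTowerZeroPrimeSigmaPGBTriplePrime₂_of_not_liftTowerZeroPrimeSigmaPGDesc₂ k n H ι h)

/-- … `¬ (E10 blob) → ¬ (Σ blob)` (49th-level). [OURS · pure logic] -/
theorem not_noseHypHostedNestEquinodalDirectCISigmaBTriplePrime₂_of_not_liftTowerZeroPrimeSigmaPGDesc₂ (k : Type) [Field k]
    [IsAlgClosed k] (n : ℕ) (H : AlgebraicGeometry.Scheme.{0}) (ι : H ⟶ (Literature.AlgebraicGeometry.Motives.projectiveSpace n k).left)
    (h : ¬ NoseHypHostedNestEquinodalDirectCILiftTowerZeroPrimeSigmaPGBTriplePrimeDesc₂ k n H ι) :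
    ¬ NoseHypHostedNestEquinodalDirectCISigmaBTriplePrime₂ k n H ι :=
  not_noseHypHostedNestEquinodalDirectCISigmaBTriplePrime₂_of_not_liftTowerZeroPrimeSigmaPG₂ k n H ι
    (not_noseHypHostedNestEquinodalDirectCILiftTowerZeroPrimeSigmaPGBTriplePrime₂_of_not_liftTowerZeroPrimeSigmaPGDesc₂ k n H ι h)

/-- … `¬ (E10 blob) → ¬ (47th blob)`. [OURS · pure logic] -/
theorem not_noseHypHostedNestEquinodalDirectCIBTriplePrime₂_of_not_liftTowerZeroPrimeSigmaPGDesc₂ (k : Type) [Field k]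
    [IsAlgClosed k] (n : ℕ) (H : AlgebraicGeometry.Scheme.{0}) (ι : H ⟶ (Literature.AlgebraicGeometry.Motives.projectiveSpace n k).left)
    (h : ¬ NoseHypHostedNestEquinodalDirectCILiftTowerZeroPrimeSigmaPGBTriplePrimeDesc₂ k n H ι) :
    ¬ NoseHypHostedNestEquinodalDirectCIBTriplePrime₂ k n H ι :=
  not_noseHypHostedNestEquinodalDirectCIBTriplePrime₂_of_not_liftTowerZeroPrimeSigmaPG₂ k n H ι
    (not_noseHypHostedNestEquinodalDirectCILiftTowerZeroPrimeSigmaPGBTriplePrime₂_of_not_liftTowerZeroPrimeSigmaPGDesc₂ k n H ι h)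

/-- … `¬ (E10 blob) → ¬ (46th blob)`. [OURS · pure logic] -/
theorem not_noseHypHostedNestEquinodalDirectBTriplePrime₂_of_not_liftTowerZeroPrimeSigmaPGDesc₂ (k : Type) [Field k]
    [IsAlgClosed k] (n : ℕ) (H : AlgebraicGeometry.Scheme.{0}) (ι : H ⟶ (Literature.AlgebraicGeometry.Motives.projectiveSpace n k).left)
    (h : ¬ NoseHypHostedNestEquinodalDirectCILiftTowerZeroPrimeSigmaPGBTriplePrimeDesc₂ k n H ι) :
    ¬ NoseHypHostedNestEquinodalDirectBTriplePrime₂ k n H ι :=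
  not_noseHypHostedNestEquinodalDirectBTriplePrime₂_of_not_liftTowerZeroPrimeSigmaPG₂ k n H ι
    (not_noseHypHostedNestEquinodalDirectCILiftTowerZeroPrimeSigmaPGBTriplePrime₂_of_not_liftTowerZeroPrimeSigmaPGDesc₂ k n H ι h)

/-- … `¬ (E10 blob) → ¬ blob₃ᵉ v2`. [OURS · pure logic] -/
theorem not_noseHypHostedNestEquinodalBTriplePrime₂_of_not_liftTowerZeroPrimeSigmaPGDesc₂ (k : Type) [Field k]
    [IsAlgClosed k] (n : ℕ) (H : AlgebraicGeometry.Scheme.{0}) (ι : H ⟶ (Literature.AlgebraicGeometry.Motives.projectiveSpace n k).left)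
    (h : ¬ NoseHypHostedNestEquinodalDirectCILiftTowerZeroPrimeSigmaPGBTriplePrimeDesc₂ k n H ι) :
    ¬ NoseHypHostedNestEquinodalBTriplePrime₂ k n H ι :=
  not_noseHypHostedNestEquinodalBTriplePrime₂_of_not_liftTowerZeroPrimeSigmaPG₂ k n H ι
    (not_noseHypHostedNestEquinodalDirectCILiftTowerZeroPrimeSigmaPGBTriplePrime₂_of_not_liftTowerZeroPrimeSigmaPGDesc₂ k n H ι h)

/-- … `¬ (E10 blob) → ¬ blob₂`. [OURS · pure logic] -/
theorem not_noseHypHostedNestBTriplePrime₂_of_not_liftTowerZeroPrimeSigmaPGDesc₂ (k : Type) [Field k]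
    [IsAlgClosed k] (n : ℕ) (H : AlgebraicGeometry.Scheme.{0}) (ι : H ⟶ (Literature.AlgebraicGeometry.Motives.projectiveSpace n k).left)
    (h : ¬ NoseHypHostedNestEquinodalDirectCILiftTowerZeroPrimeSigmaPGBTriplePrimeDesc₂ k n H ι) :
    ¬ NoseHypHostedNestBTriplePrime₂ k n H ι :=
  not_noseHypHostedNestBTriplePrime₂_of_not_liftTowerZeroPrimeSigmaPG₂ k n H ι
    (not_noseHypHostedNestEquinodalDirectCILiftTowerZeroPrimeSigmaPGBTriplePrime₂_of_not_liftTowerZeroPrimeSigmaPGDesc₂ k n H ι h)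

/-- … `¬ (E10 blob) → ¬ NoseHypPointsFirstBTriplePrime`. [OURS · pure logic] -/
theorem not_noseHypPointsFirstBTriplePrime_of_not_liftTowerZeroPrimeSigmaPGDesc₂ (k : Type) [Field k]
    [IsAlgClosed k] (n : ℕ) (H : AlgebraicGeometry.Scheme.{0}) (ι : H ⟶ (Literature.AlgebraicGeometry.Motives.projectiveSpace n k).left)
    (h : ¬ NoseHypHostedNestEquinodalDirectCILiftTowerZeroPrimeSigmaPGBTriplePrimeDesc₂ k n H ι) :
    ¬ NoseHypPointsFirstBTriplePrime k n H ι :=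
  not_noseHypPointsFirstBTriplePrime_of_not_liftTowerZeroPrimeSigmaPG₂ k n H ι
    (not_noseHypHostedNestEquinodalDirectCILiftTowerZeroPrimeSigmaPGBTriplePrime₂_of_not_liftTowerZeroPrimeSigmaPGDesc₂ k n H ι h)

end Summit.ResolutionOfSingularities.ResolutionOfSingularities.Cruxes.EquisingularLiftNat.Sections

end
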